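import Summits.BirchSwinnertonDyer.BirchSwinnertonDyer.Theorems.SignedLowerHalvesKobayashiLowerHalfLargeImageCongruenceShapeCert
import Summits.BirchSwinnertonDyer.BirchSwinnertonDyer.Theorems.SignedLowerHalvesKobayashiMainConjectureSmallImageMuTransferCM
import HarnessLib

/-!
# Route `SignedLowerHalves`, crux `KobayashiMainConjectureSmallImage` (item stmt-BirchSwinnertonDyer-19002):
# the congruence road at SMALL image («L4-λ») — Greenberg–Vatsal at a supersingular prime WITHOUT Kato's
# integrality: Kobayashi's signed main conjecture AT A PAIR of any rank and any image from a partner whose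
# `(μ, λ)(X^ε)` is known, the pair's own Mazur–Tate certificate and B. D. Kim 2009 (cell `bsd-ssimc`, seat
# `bsd-ssimc-k3-c4` gen 6; a `--supports stmt-BirchSwinnertonDyer-19002 --as helper` file; closes nothing)

PARTITION (cell bsd-ssimc): X7 (A7) × item 4's 79 CM-EC-partnered non-surjective `a_p = 0` window pairs,
ALL ranks — types-the-object-of (a rank-blind, BSDp-free, preprint-free per-pair road; records are a
separate file) ; the crux `KobayashiMainConjectureSmallImage` stays OPEN (its registered stub
`stub_lowerSmallImage` has no engine); nothing booked; BSD is not proved by any of this. THEOREMS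
ONLY: no definition, no named fact, nothing about any curve asserted.

## The road (planner D23-7; the small-image twin of k3-c3's `CongruenceRoad`, p463555 / p465598)

Fix `E = W` (globally minimal), `p` odd good with `a_p = 0`, a sign `ε`; NO hypothesis on the image of
`ρ̄_{E,p}`. For every datum `(κ, γ, f, ϖ, (L⁺, L⁻), D)` of `KobayashiMainConjecture W p ε`, with `ξ` a
generator of `char X^ε(E/ℚ_∞)` and `L = L^ε_p(E)` (Kobayashi's labelling, `kobayashiL`):
1. a PARTNER `E′ = W′` (good at `p`, `a_p(E′) = 0`, `E[p] ≃ E′[p]` `Γ_ℚ`-equivariantly) whose signed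
   dual data all have `μ(X^ε(E′)) = 0` and `λ(X^ε(E′)) = l′` (`hml′`; §1 supplies it for a CM partner
   from Pollack–Rubin's main conjecture + the partner's OWN two-engine certificate `(μ, λ)(L^ε_p(E′)) =
   (0, l′)`, the period ratio being a `p`-adic unit);
2. B. D. Kim 2009 Cor. 2.13 (μ-half, `h09`, p446809): `μ(X^ε(E)) = 0` — so `ξ` has unit content, and
   Kobayashi's Thm. 4.1 in its RATIONAL clause (`h41`: `pⁿ·L ∈ char X^ε`, NO image hypothesis) becomes
   integral by Gauss' lemma (`signedUpper_dvd_of_hasUnitContent`, g4 p447454): `ξ ∣ L` — this is the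
   one step where k3-c3's large-image road used surjectivity (Kato integral, Wuthrich Lemma 20);
3. the pair's OWN two-engine certificate `(μ, λ)(L) = (0, l)` (`hcert₀`, at the conductor; §3 reads it
   off one Mazur–Tate element by `lam_signed_neg_one/one_eq_of_mazurTate'`);
4. B. D. Kim 2009 Cor. 2.13 (λ-half) ∘ Cor. 2.5 ∘ Prop. 2.6 (`hKim`, p461917): `λ(X^ε(E)) + Σ_{S₀} δ_E =
   l′ + Σ_{S₀} δ_{E′}` with Greenberg–Vatsal's `δ = s_ℓ d_ℓ` (`GreenbergVatsal2000.delta` — ONE convention,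
   the place toolkit of p465598 evaluates it per record), `S₀ ∌ p` finite containing the bad places of both;
5. the decidable bookkeeping `hδ : l + Σ δ_E = l′ + Σ δ_{E′}` gives `λ(ξ) = l = λ(L)`, and with
   `μ(L) = 0 ≤ μ(ξ)` the cofactor is a unit (`span_eq_span_iff_mu_le_and_lam_le`): `(ξ) = (L)`; `ϖ ∈ ℤ_p^×`
   by the period-unit facts `h5`/`h3`. Hence `KobayashiMainConjecture W p ε` VERBATIM (§2).
No BSDp(E) input, no rank hypothesis, no Surj, NO PREPRINT: the Corpuz–Lei binder of the line of record
L4-CM (p422273) is replaced, for every rank, by PUBLISHED facts + two displayed certificates — the rank-0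
road L4-PUB (p447806, `BSD(E,p)` as input) and the rank-1 squeeze (p450713, `λ = 1`) are the cases where
`l_alg` is read off `BSD(E,p)` / the control theorem instead of a partner's `λ`.
SIGN DICTIONARY (ONE convention, the tree's, as in p463555): `ε : ℤˣ` is Kobayashi's sign of `Sel^ε`; an
ODD Mazur–Tate layer `n` certifies `ε = −1` (tree `L⁺`), an EVEN layer `ε = 1` (tree `L⁻`).
LITERATURE (why the analytic side is a certificate and not a fact): the signed ANALYTIC transfer
(`μ/λ` of `L^±_p` along `E[p] ≅ E′[p]`) has no refereed source at weight 2 — Pollack–Weston 2011 cite it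
to [GIP] "in preparation" (never appeared), Corpuz–Lei arXiv:2508.09733 Thm 5.3 is a 2025 preprint,
Kim–Lee–Ponsinet arXiv:1909.01764 assume the image contains SL₂(𝔽_p); the ALGEBRAIC side is published
(B. D. Kim 2009). So E's `(μ, λ)(L^ε_p)` enters per pair as a two-engine Mazur–Tate certificate.

References: [Kobayashi2003] Conj. (p. 2), Thm. 1.2, Thm. 4.1 (p. 8), (3.6); [BDKim2009] Cor. 2.13, 2.5,
Prop. 2.6 (pp. 185–187); [PollackRubin2004] Thm. (p. 448); [GreenbergVatsal2000] Prop. (2.4), §3 Rem. 3.4;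
[Pollack2003] Def. 6.15, Prop. 6.9/6.10/6.18; [PollackWeston2011] p. 351 and ref. [GIP].
-/

set_option autoImplicit false
set_option linter.dupNamespace false
noncomputable section

open scoped Classical MatrixGroups ModularForm BigOperators

open CongruenceSubgroup WeierstrassCurve NumberField IsDedekindDomain
  Literature.NumberTheory.EllipticCurves
  Literature.NumberTheory.EllipticCurves.ModularForms
  Literature.NumberTheory.EllipticCurves.Rank1Residual
  Literature.NumberTheory.EllipticCurves.Rank1Residual.Typed
  Literature.NumberTheory.EllipticCurves.Kobayashi2003 ZpExtension
  Literature.NumberTheory.EllipticCurves.GreenbergVatsal2000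
  Literature.NumberTheory.EllipticCurves.BDKim2009
  Summit.BirchSwinnertonDyer.Rank1Residual.X1.MuLambda
  Summit.BirchSwinnertonDyer.Rank1Residual.Supersingular

namespace Summit.BirchSwinnertonDyer.BirchSwinnertonDyer.Theorems.SmallImageCongruenceRoad

variable {W : WeierstrassCurve ℚ} [W.IsElliptic] [W.IsGloballyMinimal] {p : ℕ} [Fact p.Prime]

/-! ### §1 The partner's `(μ, λ)(X^ε)` from Pollack–Rubin + its own certificate (CM partner) -/

/-- **CM partner: `μ(X^ε(E′/ℚ_∞)) = 0` and `λ(X^ε(E′/ℚ_∞)) = l′` from Pollack–Rubin's main conjecture and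
the partner's OWN certificate.** For `E′ = W′` with complex multiplication (`W′.HasCM`), good
supersingular at the odd `p` with `a_p(E′) = 0`, its newform `f₀′` (level `N_{E′}`) and a two-engine
certificate `hcert₀′ : (μ, λ)(L′^ε) = (0, l′)` for every `L′^ε` of `f₀′` in Kobayashi's labelling
(`IsSignedPAdicLFunction`): every Pontryagin-dual datum `D′` of `Sel^ε(E′/ℚ_∞)` (f.g. torsion) has
`μ(D′.X) = 0` and `λ(D′.X) = l′`. Inputs BY NAME: Pollack–Rubin 2004 (`hPR`: `char X^ε(E′) = (g′)`,
`ι g′ = ϖ′·ι L′^ε`), the period-unit facts `h5`/`h3` (`ϖ′ ∈ ℤ_p^×`, so `(g′) = (L′^ε)`), Pollack 2003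
(`hPollack`, a Pollack pair for `f₀′`), modularity (`hmod`, the period ratio `ϖ′`). PER PARTNER; nothing
asserted about any curve. [cite: PollackRubin2004, Theorem (p. 448) = Thm. 7.3]
[cite: Kobayashi2003, (3.6) (p. 7) and Conjecture (p. 2)] [cite: GreenbergVatsal2000, §3 Remark 3.4]
[cite: Pollack2003, Prop. 6.18] -/
theorem mu_eq_zero_and_lambdaInvariant_eq_of_pollackRubin_of_cert
    (hPR : PollackRubin2004.mainTheorem_signedCharIdeal_eq_of_cm)
    (h5 : realPeriodRat_eq_unit_mul_plusPeriod) (h3 : realPeriodRat_eq_unit_mul_plusPeriod_three)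
    {W' : WeierstrassCurve ℚ} [W'.IsElliptic] [W'.IsGloballyMinimal]
    (hPollack : ∀ {N : ℕ} [NeZero N] {f : CuspForm (Gamma0 N) 2},
      pollack_exists_plusMinusPAdicLFunction (W := W') (f := f) (p := p))
    (hmod : nonempty_modularParametrizationData)
    (hp : p ≠ 2) (hcm' : W'.HasCM) (hss' : GoodSS W' p) (hap' : W'.frobeniusTrace p = 0) (ε : ℤˣ)
    [NeZero (W'.conductorNorm ℤ)] {f₀' : CuspForm (Gamma0 (W'.conductorNorm ℤ)) 2}
    (hf₀' : IsNewformOf W' f₀') {l' : ℕ}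
    (hcert₀' : ∀ L' : IwasawaAlgebra p, IsSignedPAdicLFunction f₀' p ε L' → mu L' = 0 ∧ lam L' = l') :
    ∀ (κ : ZpExtension ℚ p) (γ : Field.absoluteGaloisGroup ℚ), κ.IsCyclotomic →
      κ.IsTopGenerator γ → IsCyclotomicVariable p γ → ∀ (D' : SignedSelmerDualData W' κ γ ε)
      [Module.Finite (IwasawaAlgebra p) D'.X], Module.IsTorsion (IwasawaAlgebra p) D'.X →
      muInvariant p D'.X = 0 ∧ lambdaInvariant p D'.X = l' := by
  intro κ γ hκ hγ hγ' D' _ hX'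
  -- modularity: the period ratio `ϖ′` of the newform `f₀′`
  obtain ⟨Dm⟩ := hmod W'
  have hff : Dm.f = f₀' := Dm.isNewformOf.unique hf₀'
  obtain ⟨ϖ', hϖpos, hϖ', -⟩ := Dm.exists_rat_mul_realPeriodRat_eq_plusPeriod
  rw [hff] at hϖ'
  -- a Pollack pair for `f₀′` and Kobayashi's `L′^ε`
  obtain ⟨Lplus, Lminus, hPP'⟩ := exists_isPollackPair hPollack hp hf₀' hss'.1 hap'
  set L' := kobayashiL ε Lplus Lminus with hL'_def
  have hL' : IsSignedPAdicLFunction f₀' p ε L' := hPP'.isSignedPAdicLFunction_kobayashiL ε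
  obtain ⟨hμL', hlamL'⟩ := hcert₀' L' hL'
  have hL'0 : L' ≠ 0 := by
    rw [hL'_def]
    unfold kobayashiL
    split_ifs
    · exact hPP'.2.1
    · exact hPP'.1
  -- Pollack–Rubin: `char X^ε(E′) = (g′)`, `ι g′ = ϖ′ · ι L′^ε`
  obtain ⟨-, g', hg', hι'⟩ :=
    kobayashiMainConjecture_of_pollackRubin_of_goodSS W' p hPR hcm' hp hss' ε κ γ hκ hγ hγ' f₀' hf₀' ϖ'
      hϖ' Lplus Lminus hPP' D'
  -- `ϖ′ ∈ ℤ_p^×`, so `g′ = C(u) · L′` and `(g′) = (L′)`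
  have hirr' : W'.HasIrreducibleModPGaloisRep p :=
    hasIrreducibleModPGaloisRep_of_dvd_frobeniusTrace W' p hp
      (W'.not_dvd_minimalDiscriminantInt_of_hasGoodReductionAtPrime' p hss'.1) hss'.2
  have hvϖ : padicValRat p ϖ' = 0 :=
    padicValRat_periodRatio_eq_zero h5 h3 W' p hp hss'.1 hirr' f₀' hf₀' ϖ' hϖ'
  obtain ⟨u, hu⟩ := exists_units_coe_eq_ratCast hϖpos.ne' hvϖ
  obtain ⟨hspan', hιu⟩ := span_C_units_mul_eq u L'
  have hgeq : g' = PowerSeries.C (u : ℤ_[p]) * L' :=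
    iwasawaToPowerSeries_injective p (by rw [hι', hιu, hu])
  have hgL' : D'.charIdeal = Ideal.span {L'} := by rw [hg', hgeq, hspan']
  refine ⟨?_, ?_⟩
  · rw [← Summit.BirchSwinnertonDyer.Rank1Residual.X1.MuPart.mu_generator_eq_muInvariant D'.X hX' hL'0 hgL']
    exact hμL'
  · rw [← Summit.BirchSwinnertonDyer.Rank1Residual.X1.ParitySqueeze.lam_generator_eq_lambdaInvariant D'.X
      hX' hL'0 hgL']
    exact hlamL'

/-! ### §2 The road: Kobayashi's main conjecture at a pair of ANY image from a partner's `(μ, λ)` -/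

/-- **Kobayashi's main conjecture for `(E, p, ε)` AT THE PAIR from the small-image congruence road,
certificate at the conductor.** Inputs BY NAME: Kobayashi 2003 Thm. 1.2 (`h12`), Thm. 4.1 RATIONAL clause
(`h41`; NO image hypothesis), the period-unit facts (`h5`, `h3`), B. D. Kim 2009 Cor. 2.13 μ-half
(`h09`) and λ-half ∘ Cor. 2.5 ∘ Prop. 2.6 (`hKim`); per-pair DATA: `p` odd good, `a_p = 0`, the newform
`f₀` of `E` and its two-engine certificate `hcert₀ : (μ, λ)(L^ε_p(E)) = (0, l)`, a partner `W′` good at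
`p` with `a_p(W′) = 0` and `W[p] ≃ W′[p]` (`he`) whose signed dual data have `μ = 0` and `λ = l′`
(`hml′`, e.g. §1), a finite set `S₀` of places away from `p` containing the bad places of both curves,
and the identity `hδ : l + Σ_{S₀} δ_W = l′ + Σ_{S₀} δ_{W′}`. Conclusion: `KobayashiMainConjecture W p ε`
VERBATIM — no `Surj`, no rank, no `BSD(E,p)`, no preprint. PER PAIR; NOT a class theorem about the crux;
closes nothing. [cite: Kobayashi2003, Thm. 1.2, Thm. 4.1 (p. 8) and Conjecture (p. 2)]
[cite: BDKim2009, Cor. 2.13, Cor. 2.5 and Prop. 2.6 (pp. 185–187)] [cite: GreenbergVatsal2000, §2 Prop. (2.4) and §3 Remark 3.4]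
[cite: Washington1997, §13.1 and §7.1] -/
theorem kobayashiMainConjecture_of_lambdaTransfer_of_mu_at_conductor
    (h12 : Kobayashi2003.thm12_signedSelmerDual_finite_torsion)
    (h41 : Kobayashi2003.thm41_signedCharIdeal_divisibility)
    (h5 : realPeriodRat_eq_unit_mul_plusPeriod) (h3 : realPeriodRat_eq_unit_mul_plusPeriod_three)
    (h09 : cor213_signedMu_eq_zero_iff_of_torsionIso)
    (hKim : BDKim2009.cor213_signedLambda_add_sum_delta_eq_of_torsionIso)
    (hp : p ≠ 2) (hgood : W.HasGoodReductionAtPrime p) (hap : W.frobeniusTrace p = 0) (ε : ℤˣ) {l : ℕ}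
    [NeZero (W.conductorNorm ℤ)] {f₀ : CuspForm (Gamma0 (W.conductorNorm ℤ)) 2} (hf₀ : IsNewformOf W f₀)
    (hcert₀ : ∀ L : IwasawaAlgebra p, IsSignedPAdicLFunction f₀ p ε L → mu L = 0 ∧ lam L = l)
    {W' : WeierstrassCurve ℚ} [W'.IsElliptic] [W'.IsGloballyMinimal]
    (hgood' : W'.HasGoodReductionAtPrime p) (hap' : W'.frobeniusTrace p = 0)
    (he : ∃ e : geomTorsion W (p : ℤ) ≃+ geomTorsion W' (p : ℤ),
      ∀ (σ : Field.absoluteGaloisGroup ℚ) (P : geomTorsion W (p : ℤ)), e (σ • P) = σ • e P)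
    {l' : ℕ}
    (hml' : ∀ (κ : ZpExtension ℚ p) (γ : Field.absoluteGaloisGroup ℚ), κ.IsCyclotomic →
      κ.IsTopGenerator γ → IsCyclotomicVariable p γ → ∀ (D' : SignedSelmerDualData W' κ γ ε)
      [Module.Finite (IwasawaAlgebra p) D'.X], Module.IsTorsion (IwasawaAlgebra p) D'.X →
      muInvariant p D'.X = 0 ∧ lambdaInvariant p D'.X = l')
    (S₀ : Finset (HeightOneSpectrum (𝓞 ℚ))) (hS₀ : ∀ v ∈ S₀, ((p : ℕ) : 𝓞 ℚ) ∉ v.asIdeal)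
    (hS₀W : ∀ v : HeightOneSpectrum (𝓞 ℚ), ¬ W.HasGoodReductionAt v → v ∈ S₀)
    (hS₀W' : ∀ v : HeightOneSpectrum (𝓞 ℚ), ¬ W'.HasGoodReductionAt v → v ∈ S₀)
    (hδ : l + ∑ v ∈ S₀, delta W p v = l' + ∑ v ∈ S₀, delta W' p v) :
    KobayashiMainConjecture W p ε := by
  intro κ γ hκ hγ hγ' _ f hf ϖ hϖ Lplus Lminus hPP D
  -- the newform of the quantifier is `f₀`
  have hff : f = f₀ := hf.unique hf₀
  subst hff
  -- Thm. 1.2: `X^ε(E)` finitely generated and torsion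
  haveI : Module.Finite (IwasawaAlgebra p) D.X := h12.moduleFinite hp hgood hap hκ hγ D
  have hX : Module.IsTorsion (IwasawaAlgebra p) D.X := h12.isTorsion hp hgood hap hκ hγ D
  refine ⟨hX, ?_⟩
  -- a generator `ξ` of `Char(X^ε(E))` and Kobayashi's `L^ε_p(E)`
  obtain ⟨ξ, hξ⟩ := (charIdeal_isPrincipal_holds p D.X).principal
  have hξ' : D.charIdeal = Ideal.span {ξ} := hξ
  set L := kobayashiL ε Lplus Lminus with hL_def
  have hL : IsSignedPAdicLFunction f p ε L := hPP.isSignedPAdicLFunction_kobayashiL ε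
  obtain ⟨hμL, hlamL⟩ := hcert₀ L hL
  have hL0 : L ≠ 0 := by
    rw [hL_def]
    unfold kobayashiL
    split_ifs
    · exact hPP.2.1
    · exact hPP.1
  -- the partner's datum: `μ = 0`, `λ = l′`
  obtain ⟨D'⟩ := nonempty_signedSelmerDualData W' κ ε hγ
  haveI : Module.Finite (IwasawaAlgebra p) D'.X := h12.moduleFinite hp hgood' hap' hκ hγ D'
  have hX' : Module.IsTorsion (IwasawaAlgebra p) D'.X := h12.isTorsion hp hgood' hap' hκ hγ D'
  obtain ⟨hμD', hlamD'⟩ := hml' κ γ hκ hγ hγ' D' hX'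
  -- B. D. Kim 2009, μ-half: `μ(X^ε(E)) = 0`, i.e. `ξ` has unit content
  have hDmu : D.mu = 0 := (h09 W W' p hp hgood hap hgood' hap' he κ γ hκ hγ ε D D' hX hX').mpr hμD'
  have hu : HasUnitContent ξ := (muInvariant_eq_zero_iff_hasUnitContent D.X hX hξ').mp hDmu
  -- Kobayashi Thm. 4.1 (rational) + Gauss: `ξ ∣ L` with NO image hypothesis
  have hU : ξ ∣ L := signedUpper_dvd_of_hasUnitContent h41 hp hgood hap hf hκ hγ hγ' hL D hX hξ' hu
  obtain ⟨h, hfac⟩ := hU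
  have hξ0 : ξ ≠ 0 := by
    rintro rfl
    exact hL0 (by rw [hfac, zero_mul])
  -- B. D. Kim 2009, λ-half: `λ(X^ε(E)) = l`
  have hT := hKim W W' p hp hgood hap hgood' hap' he κ γ hκ hγ S₀ hS₀ hS₀W hS₀W' ε D D' hX hX' hDmu
  have hlamD : lambdaInvariant p D.X = l := by
    rw [hlamD'] at hT
    omega
  have hlamξ : lam ξ = l := by
    rw [Summit.BirchSwinnertonDyer.Rank1Residual.X1.ParitySqueeze.lam_generator_eq_lambdaInvariant D.X hX
      hξ0 hξ, hlamD]
  -- the squeeze: `(ξ) = (L)`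
  have hspan : Ideal.span ({ξ} : Set (IwasawaAlgebra p)) = Ideal.span {L} :=
    ((span_eq_span_iff_mu_le_and_lam_le hξ0 hL0 hfac).mpr
      ⟨by rw [hμL]; exact Nat.zero_le _, by rw [hlamL, hlamξ]⟩).symm
  -- the period ratio `ϖ` is a `p`-adic unit (`E[p]` irreducible at a supersingular odd `p`)
  have hirr : W.HasIrreducibleModPGaloisRep p :=
    hasIrreducibleModPGaloisRep_of_dvd_frobeniusTrace W p hp
      (W.not_dvd_minimalDiscriminantInt_of_hasGoodReductionAtPrime' p hgood) (by rw [hap]; exact dvd_zero _)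
  have hvϖ : padicValRat p ϖ = 0 := padicValRat_periodRatio_eq_zero h5 h3 W p hp hgood hirr f hf ϖ hϖ
  have hϖ0 : ϖ ≠ 0 := by
    intro h0
    rw [h0, Rat.cast_zero, zero_mul] at hϖ
    exact (IsNewform0.plusPeriod_pos_holds hf.1 hf.coeffField_eq_bot).ne' hϖ.symm
  obtain ⟨u, hu'⟩ := exists_units_coe_eq_ratCast hϖ0 hvϖ
  obtain ⟨hspan', hι⟩ := span_C_units_mul_eq u L
  refine ⟨PowerSeries.C (u : ℤ_[p]) * L, ?_, ?_⟩
  · rw [hξ', hspan, hspan']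
  · rw [hι, hu']

/-! ### §3 Both certificates read off Mazur–Tate elements; the CM-partner form of the road -/

/-- **The small-image congruence road with a CM partner, ODD layers (`ε = −1`, the tree's `L⁺`).** Data:
the newform `f₀` of `E = W` and `Θ ∈ Λ` with `ι Θ = θ_n(f₀)`, `n` odd, `Θ ≠ 0`, `μ(Θ) = 0`,
`λ(Θ) = deg ω_n^+ + l` (two engines) — this IS `(μ, λ)(L^{−1}_p(E)) = (0, l)`
(`lam_signed_neg_one_eq_of_mazurTate'`) —; a CM partner `W′` (good supersingular at `p`, `a_p(W′) = 0`
an explicit datum, `W[p] ≃ W′[p]`) with ITS newform `f₀′` and `Θ′`, `ι Θ′ = θ_{n′}(f₀′)`, `n′` odd,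
`Θ′ ≠ 0`, `μ(Θ′) = 0`, `λ(Θ′) = deg ω_{n′}^+ + l′`; `S₀`, `hδ` as in §2. Inputs BY NAME: `h12`, `h41`
(rational), `h5`, `h3`, `h09`, `hKim`, Pollack–Rubin `hPR`, Pollack `hPollack`, modularity `hmod`.
Conclusion `KobayashiMainConjecture W p (-1)`. PER PAIR; closes nothing.
[cite: Pollack2003, Def. 6.15, Prop. 6.9, 6.10 and 6.18] [cite: Kobayashi2003, Thm. 4.1 (p. 8) and Conjecture (p. 2)]
[cite: BDKim2009, Cor. 2.13, Cor. 2.5 and Prop. 2.6 (pp. 185–187)] [cite: PollackRubin2004, Theorem (p. 448) = Thm. 7.3] -/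
theorem kobayashiMainConjecture_neg_one_of_cmPartner_of_mazurTate
    (h12 : Kobayashi2003.thm12_signedSelmerDual_finite_torsion)
    (h41 : Kobayashi2003.thm41_signedCharIdeal_divisibility)
    (h5 : realPeriodRat_eq_unit_mul_plusPeriod) (h3 : realPeriodRat_eq_unit_mul_plusPeriod_three)
    (h09 : cor213_signedMu_eq_zero_iff_of_torsionIso)
    (hKim : BDKim2009.cor213_signedLambda_add_sum_delta_eq_of_torsionIso)
    (hPR : PollackRubin2004.mainTheorem_signedCharIdeal_eq_of_cm)
    (hmod : nonempty_modularParametrizationData)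
    (hp : p ≠ 2) (hgood : W.HasGoodReductionAtPrime p) (hap : W.frobeniusTrace p = 0) {l : ℕ}
    [NeZero (W.conductorNorm ℤ)] {f₀ : CuspForm (Gamma0 (W.conductorNorm ℤ)) 2} (hf₀ : IsNewformOf W f₀)
    {n : ℕ} (hn : Odd n) {Θ : IwasawaAlgebra p}
    (hΘ : iwasawaToPowerSeries p Θ =
      ((mazurTateElement f₀ p n).map (algebraMap ℚ ℚ_[p]) : PowerSeries ℚ_[p]))
    (hΘ0 : Θ ≠ 0) (hμ : mu Θ = 0) (hlam : lam Θ = (cyclotomicOmegaPlus p n).natDegree + l)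
    {W' : WeierstrassCurve ℚ} [W'.IsElliptic] [W'.IsGloballyMinimal]
    (hPollack : ∀ {N : ℕ} [NeZero N] {f : CuspForm (Gamma0 N) 2},
      pollack_exists_plusMinusPAdicLFunction (W := W') (f := f) (p := p))
    (hcm' : W'.HasCM) (hss' : GoodSS W' p) (hap' : W'.frobeniusTrace p = 0)
    (he : ∃ e : geomTorsion W (p : ℤ) ≃+ geomTorsion W' (p : ℤ),
      ∀ (σ : Field.absoluteGaloisGroup ℚ) (P : geomTorsion W (p : ℤ)), e (σ • P) = σ • e P)
    {l' : ℕ} [NeZero (W'.conductorNorm ℤ)] {f₀' : CuspForm (Gamma0 (W'.conductorNorm ℤ)) 2}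
    (hf₀' : IsNewformOf W' f₀') {n' : ℕ} (hn' : Odd n') {Θ' : IwasawaAlgebra p}
    (hΘ' : iwasawaToPowerSeries p Θ' =
      ((mazurTateElement f₀' p n').map (algebraMap ℚ ℚ_[p]) : PowerSeries ℚ_[p]))
    (hΘ'0 : Θ' ≠ 0) (hμ' : mu Θ' = 0) (hlam' : lam Θ' = (cyclotomicOmegaPlus p n').natDegree + l')
    (S₀ : Finset (HeightOneSpectrum (𝓞 ℚ))) (hS₀ : ∀ v ∈ S₀, ((p : ℕ) : 𝓞 ℚ) ∉ v.asIdeal)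
    (hS₀W : ∀ v : HeightOneSpectrum (𝓞 ℚ), ¬ W.HasGoodReductionAt v → v ∈ S₀)
    (hS₀W' : ∀ v : HeightOneSpectrum (𝓞 ℚ), ¬ W'.HasGoodReductionAt v → v ∈ S₀)
    (hδ : l + ∑ v ∈ S₀, delta W p v = l' + ∑ v ∈ S₀, delta W' p v) :
    KobayashiMainConjecture W p (-1) :=
  kobayashiMainConjecture_of_lambdaTransfer_of_mu_at_conductor h12 h41 h5 h3 h09 hKim hp hgood hap (-1) hf₀
    (fun _ hL ↦ lam_signed_neg_one_eq_of_mazurTate' hp hf₀ hgood hap hL hn hΘ hΘ0 hμ hlam)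
    hss'.1 hap' he
    (mu_eq_zero_and_lambdaInvariant_eq_of_pollackRubin_of_cert hPR h5 h3 hPollack hmod hp hcm' hss' hap'
      (-1) hf₀' (fun _ hL' ↦ lam_signed_neg_one_eq_of_mazurTate' hp hf₀' hss'.1 hap' hL' hn' hΘ' hΘ'0 hμ' hlam'))
    S₀ hS₀ hS₀W hS₀W' hδ

/-- **The small-image congruence road with a CM partner, EVEN layers (`ε = 1`, the tree's `L⁻`)**:
`n`, `n′` even, `λ(Θ) = deg ω_n^- + l`, `λ(Θ′) = deg ω_{n′}^- + l′`. PER PAIR; closes nothing.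
[cite: Pollack2003, Def. 6.15, Prop. 6.9, 6.10 and 6.18] [cite: Kobayashi2003, Thm. 4.1 (p. 8) and Conjecture (p. 2)]
[cite: BDKim2009, Cor. 2.13, Cor. 2.5 and Prop. 2.6 (pp. 185–187)] [cite: PollackRubin2004, Theorem (p. 448) = Thm. 7.3] -/
theorem kobayashiMainConjecture_one_of_cmPartner_of_mazurTate
    (h12 : Kobayashi2003.thm12_signedSelmerDual_finite_torsion)
    (h41 : Kobayashi2003.thm41_signedCharIdeal_divisibility)
    (h5 : realPeriodRat_eq_unit_mul_plusPeriod) (h3 : realPeriodRat_eq_unit_mul_plusPeriod_three)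
    (h09 : cor213_signedMu_eq_zero_iff_of_torsionIso)
    (hKim : BDKim2009.cor213_signedLambda_add_sum_delta_eq_of_torsionIso)
    (hPR : PollackRubin2004.mainTheorem_signedCharIdeal_eq_of_cm)
    (hmod : nonempty_modularParametrizationData)
    (hp : p ≠ 2) (hgood : W.HasGoodReductionAtPrime p) (hap : W.frobeniusTrace p = 0) {l : ℕ}
    [NeZero (W.conductorNorm ℤ)] {f₀ : CuspForm (Gamma0 (W.conductorNorm ℤ)) 2} (hf₀ : IsNewformOf W f₀)
    {n : ℕ} (hn : Even n) {Θ : IwasawaAlgebra p}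
    (hΘ : iwasawaToPowerSeries p Θ =
      ((mazurTateElement f₀ p n).map (algebraMap ℚ ℚ_[p]) : PowerSeries ℚ_[p]))
    (hΘ0 : Θ ≠ 0) (hμ : mu Θ = 0) (hlam : lam Θ = (cyclotomicOmegaMinus p n).natDegree + l)
    {W' : WeierstrassCurve ℚ} [W'.IsElliptic] [W'.IsGloballyMinimal]
    (hPollack : ∀ {N : ℕ} [NeZero N] {f : CuspForm (Gamma0 N) 2},
      pollack_exists_plusMinusPAdicLFunction (W := W') (f := f) (p := p))
    (hcm' : W'.HasCM) (hss' : GoodSS W' p) (hap' : W'.frobeniusTrace p = 0)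
    (he : ∃ e : geomTorsion W (p : ℤ) ≃+ geomTorsion W' (p : ℤ),
      ∀ (σ : Field.absoluteGaloisGroup ℚ) (P : geomTorsion W (p : ℤ)), e (σ • P) = σ • e P)
    {l' : ℕ} [NeZero (W'.conductorNorm ℤ)] {f₀' : CuspForm (Gamma0 (W'.conductorNorm ℤ)) 2}
    (hf₀' : IsNewformOf W' f₀') {n' : ℕ} (hn' : Even n') {Θ' : IwasawaAlgebra p}
    (hΘ' : iwasawaToPowerSeries p Θ' =
      ((mazurTateElement f₀' p n').map (algebraMap ℚ ℚ_[p]) : PowerSeries ℚ_[p]))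
    (hΘ'0 : Θ' ≠ 0) (hμ' : mu Θ' = 0) (hlam' : lam Θ' = (cyclotomicOmegaMinus p n').natDegree + l')
    (S₀ : Finset (HeightOneSpectrum (𝓞 ℚ))) (hS₀ : ∀ v ∈ S₀, ((p : ℕ) : 𝓞 ℚ) ∉ v.asIdeal)
    (hS₀W : ∀ v : HeightOneSpectrum (𝓞 ℚ), ¬ W.HasGoodReductionAt v → v ∈ S₀)
    (hS₀W' : ∀ v : HeightOneSpectrum (𝓞 ℚ), ¬ W'.HasGoodReductionAt v → v ∈ S₀)
    (hδ : l + ∑ v ∈ S₀, delta W p v = l' + ∑ v ∈ S₀, delta W' p v) :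
    KobayashiMainConjecture W p 1 :=
  kobayashiMainConjecture_of_lambdaTransfer_of_mu_at_conductor h12 h41 h5 h3 h09 hKim hp hgood hap 1 hf₀
    (fun _ hL ↦ lam_signed_one_eq_of_mazurTate' hp hf₀ hgood hap hL hn hΘ hΘ0 hμ hlam)
    hss'.1 hap' he
    (mu_eq_zero_and_lambdaInvariant_eq_of_pollackRubin_of_cert hPR h5 h3 hPollack hmod hp hcm' hss' hap'
      1 hf₀' (fun _ hL' ↦ lam_signed_one_eq_of_mazurTate' hp hf₀' hss'.1 hap' hL' hn' hΘ' hΘ'0 hμ' hlam'))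
    S₀ hS₀ hS₀W hS₀W' hδ

/-! ### §4 Consumer: `BSD(E,p)` through the image-free roads (item 4's `∃ ε, …` at a pair is `⟨ε, §2⟩`) -/

/-- **X7 (any image) ∧ {r_an ≤ 1}: `BSD(E,p)` from the small-image congruence road** — the road gives
`KobayashiMainConjecture W p ε`, and the tree's IMAGE-FREE roads conclude: rank 0 by
`bsdp_of_kobayashiMainConjecture_of_analyticRank_eq_zero` (Kobayashi Thm. 1.2 `h12`, Kim 2013 Cor. 3.15
`hKim13`, Pollack `hPollackW`, modularity `hmod`/`hmod'`, GZK `hGZK`), rank 1 by Burungale–Kobayashi–Ota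
2024 Cor. A.5 (`hA5`, with its two displayed referee flags `BKO24-CorA5-IMC-unpinned`,
`BKO24-CorA5-proof-by-reference-Kob14`). On item 4 (non-surjective image) these are the ONLY roads and
both eat the EQUALITY, which the road delivers WITHOUT the Corpuz–Lei preprint binder of
`X7.bsdp_of_cmPartner_of_transfer_OPEN_of_analyticRank_le_one` (p422273). PER PAIR; closes nothing.
[cite: BurungaleKobayashiOta2023, App. A Cor. A.5] [cite: Kobayashi2003, Thm. 1.2 and Conjecture (p. 2)]
[cite: BDKim2013, Cor. 3.15 (p. 199)] [cite: BDKim2009, Cor. 2.13 (p. 187)] [cite: Miller2011LMS, Def. 1.1] -/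
theorem X7.bsdp_of_lambdaTransfer_of_mu_of_analyticRank_le_one
    (h12 : Kobayashi2003.thm12_signedSelmerDual_finite_torsion)
    (h41 : Kobayashi2003.thm41_signedCharIdeal_divisibility)
    (h5 : realPeriodRat_eq_unit_mul_plusPeriod) (h3 : realPeriodRat_eq_unit_mul_plusPeriod_three)
    (h09 : cor213_signedMu_eq_zero_iff_of_torsionIso)
    (hKim : BDKim2009.cor213_signedLambda_add_sum_delta_eq_of_torsionIso)
    (hA5 : BurungaleKobayashiOta2024.corA5_pPart_of_signedCharIdeal_eq)
    (hKim13 : BDKim2013.cor315_signedCharValue_rankZero)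
    (hPollackW : ∀ {N : ℕ} [NeZero N] {f : CuspForm (Gamma0 N) 2},
      pollack_exists_plusMinusPAdicLFunction (W := W) (f := f) (p := p))
    (hmod : nonempty_modularParametrizationData) (hmod' : hasEntireLFunction_rat)
    (hGZK : rank_eq_analyticRank_of_analyticRank_le_one)
    (hp : p ≠ 2) (hX : ClassX7 W p) (hap : W.frobeniusTrace p = 0) (hr : W.analyticRank ≤ 1)
    (ε : ℤˣ) {l : ℕ}
    [NeZero (W.conductorNorm ℤ)] {f₀ : CuspForm (Gamma0 (W.conductorNorm ℤ)) 2} (hf₀ : IsNewformOf W f₀)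
    (hcert₀ : ∀ L : IwasawaAlgebra p, IsSignedPAdicLFunction f₀ p ε L → mu L = 0 ∧ lam L = l)
    {W' : WeierstrassCurve ℚ} [W'.IsElliptic] [W'.IsGloballyMinimal]
    (hgood' : W'.HasGoodReductionAtPrime p) (hap' : W'.frobeniusTrace p = 0)
    (he : ∃ e : geomTorsion W (p : ℤ) ≃+ geomTorsion W' (p : ℤ),
      ∀ (σ : Field.absoluteGaloisGroup ℚ) (P : geomTorsion W (p : ℤ)), e (σ • P) = σ • e P)
    {l' : ℕ}
    (hml' : ∀ (κ : ZpExtension ℚ p) (γ : Field.absoluteGaloisGroup ℚ), κ.IsCyclotomic →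
      κ.IsTopGenerator γ → IsCyclotomicVariable p γ → ∀ (D' : SignedSelmerDualData W' κ γ ε)
      [Module.Finite (IwasawaAlgebra p) D'.X], Module.IsTorsion (IwasawaAlgebra p) D'.X →
      muInvariant p D'.X = 0 ∧ lambdaInvariant p D'.X = l')
    (S₀ : Finset (HeightOneSpectrum (𝓞 ℚ))) (hS₀ : ∀ v ∈ S₀, ((p : ℕ) : 𝓞 ℚ) ∉ v.asIdeal)
    (hS₀W : ∀ v : HeightOneSpectrum (𝓞 ℚ), ¬ W.HasGoodReductionAt v → v ∈ S₀)
    (hS₀W' : ∀ v : HeightOneSpectrum (𝓞 ℚ), ¬ W'.HasGoodReductionAt v → v ∈ S₀)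
    (hδ : l + ∑ v ∈ S₀, delta W p v = l' + ∑ v ∈ S₀, delta W' p v) : BSDp W p := by
  have hMC : KobayashiMainConjecture W p ε :=
    kobayashiMainConjecture_of_lambdaTransfer_of_mu_at_conductor h12 h41 h5 h3 h09 hKim hp hX.1.1 hap ε hf₀
      hcert₀ hgood' hap' he hml' S₀ hS₀ hS₀W hS₀W' hδ
  rcases Nat.lt_or_ge W.analyticRank 1 with h0 | h1
  · exact bsdp_of_kobayashiMainConjecture_of_analyticRank_eq_zero W p h12 hKim13 hPollackW hmod hmod' hGZK
      hp hX.1.1 hap (ClassX7.irr W p hp hX) (Nat.lt_one_iff.mp h0) hMC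
  · exact bsdp_of_kobayashiMainConjecture_of_corA5_of_analyticRank_eq_one W p hA5 hmod' hGZK hp hX.1.1
      hap (le_antisymm hr h1) ε hMC

end Summit.BirchSwinnertonDyer.BirchSwinnertonDyer.Theorems.SmallImageCongruenceRoad

end
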